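import Summits.QuantumAdvantage.AdviceFreeQNC0.WalkTransport
import Summits.QuantumAdvantage.AdviceFreeQNC0.WindowCharacters
import HarnessLib

/-!
# The pair fibre of the u-walk game: chart, weight bookkeeping, and the three-speed parity identity

Planner qa-qnc0-p2 g15's rung R7 (`WalkHardFPairLocal`, ROUND-15 (p2) §3) isolates one adjacent bit pair
`(u_a, u_{a+1})` of the input of α's u-walk game `ringWinU c y` and compares the three representative inputs of
pair weight `t = 0, 1, 2` over a fixed rest `v ∈ {0,1}^m` (`n = m + 2`).  This file is the bookkeeping layer:

* `PairLocal.emb a t v` — the fibre chart (left part `v_{<a}`, pair `([1 ≤ t], [2 ≤ t])`, right part the COMPLEMENT of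
  `v_{≥ a}`; the complement makes the hidden residue of the fibre, `c + a − |left| + |right|`, an affine function of `|v|`);
* weights along the chart (`wt_emb`, `wtPrefix_emb_of_le`, `wtPrefix_emb_of_ge`, `weight_identity`);
* the RELATIVE STATE `relSt a t g v = g + W_g + 2(a + W_a)` of a cut `g` (`≡ state(g) − state(a) (mod 3)`) and its locality
  (`relSt_mod_eq_of_agree`: it only reads the bits between the cut and the pair);
* **the three-speed parity identity** (`PairLocal.exists_speed_loses`): if the cuts far from the pair do not read it, then
  `Σ_{t<3} #{g fired at u_t : c + g + e_g(u_t) ≢ 0} ≡ Q_κ(v) (mod 2)`, where `Q_ρ(v)` counts only NEAR cuts against the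
  relative states and `κ ≡ c + |u_0| + state(a)` is the fibre's hidden residue — every far cut contributes exactly `2`
  to the sum over the three speeds (its exponent runs through all residues).  Hence if `Q_κ(v)` is even, one of the
  three representatives LOSES.  This replaces the planner's `V₄`-register lemma (`Endgame.finiteEndgame`, checked there by
  `native_decide`) by a two-line double count; `Σ_ρ Q_ρ(v)` is even, so a losing residue `ρ♭(v)` always exists
  (`Q_rhoBad_even`).
WHAT THIS IS NOT: no degree hypothesis and no hardness statement here (those are in `WalkHardFPairLocal.lean`);
separation NOT moved.
-/

namespace Summit.QuantumAdvantage.AdviceFreeQNC0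

open Finset Literature.Computability.MetaComplexity Literature.Computability.MetaComplexity.Hegedus

namespace PairLocal

variable {m : ℕ}

/-! ### The fibre chart -/

/-- The fibre chart `emb a t v ∈ {0,1}^{m+2}`: `v_{<a}`, then the pair `(u_a, u_{a+1}) = ([1 ≤ t], [2 ≤ t])`
(pair weight `t` for `t ≤ 2`), then the complement of `v_{≥ a}`. -/
def emb (a t : ℕ) (v : Fin m → Bool) : Fin (m + 2) → Bool := fun i =>
  if h₁ : i.val < a then (if h₂ : i.val < m then v ⟨i.val, h₂⟩ else false)
  else if h₂ : i.val = a then decide (1 ≤ t)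
  else if h₃ : i.val = a + 1 then decide (2 ≤ t)
  else !(v ⟨i.val - 2, by omega⟩)
/-- Chart value on the left block. -/
theorem emb_of_lt {a : ℕ} (ha : a ≤ m) (t : ℕ) (v : Fin m → Bool) (i : Fin (m + 2)) (hi : i.val < a) :
    emb a t v i = v ⟨i.val, by omega⟩ := by
  unfold emb
  rw [dif_pos hi, dif_pos (by omega)]
/-- Chart value at the first pair bit. -/
theorem emb_at_fst (a t : ℕ) (v : Fin m → Bool) (i : Fin (m + 2)) (hi : i.val = a) :
    emb a t v i = decide (1 ≤ t) := by
  unfold emb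
  rw [dif_neg (by omega), dif_pos hi]
/-- Chart value at the second pair bit. -/
theorem emb_at_snd (a t : ℕ) (v : Fin m → Bool) (i : Fin (m + 2)) (hi : i.val = a + 1) :
    emb a t v i = decide (2 ≤ t) := by
  unfold emb
  rw [dif_neg (by omega), dif_neg (by omega), dif_pos hi]
/-- Chart value on the (complemented) right block. -/
theorem emb_of_ge (a t : ℕ) (v : Fin m → Bool) (i : Fin (m + 2)) (hi : a + 2 ≤ i.val) :
    emb a t v i = !(v ⟨i.val - 2, by omega⟩) := by
  unfold emb
  rw [dif_neg (by omega), dif_neg (by omega), dif_neg (by omega)]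
/-- The three representatives agree off the pair. -/
theorem emb_agree_off_pair (a t t' : ℕ) (v : Fin m → Bool) (i : Fin (m + 2)) (h₁ : i.val ≠ a)
    (h₂ : i.val ≠ a + 1) : emb a t v i = emb a t' v i := by
  unfold emb
  by_cases hi : i.val < a
  · rw [dif_pos hi, dif_pos hi]
  · rw [dif_neg hi, dif_neg hi, dif_neg h₁, dif_neg h₁, dif_neg h₂, dif_neg h₂]
/-- The chart is injective in `(t, v)` for `t, t' ≤ 2` (the pair bits record `t`, the other bits record `v`). -/
theorem emb_inj {a : ℕ} (ha : a ≤ m) {t t' : ℕ} (ht : t < 3) (ht' : t' < 3) {v v' : Fin m → Bool}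
    (h : emb a t v = emb a t' v') : t = t' ∧ v = v' := by
  have hfst := congr_fun h ⟨a, by omega⟩
  have hsnd := congr_fun h ⟨a + 1, by omega⟩
  rw [emb_at_fst a t v _ rfl, emb_at_fst a t' v' _ rfl] at hfst
  rw [emb_at_snd a t v _ rfl, emb_at_snd a t' v' _ rfl] at hsnd
  refine ⟨?_, ?_⟩
  · have h1 : (1 ≤ t ↔ 1 ≤ t') := by
      constructor
      · intro h1; by_contra h1'; rw [decide_eq_true h1, decide_eq_false h1'] at hfst; exact Bool.noConfusion hfst
      · intro h1'; by_contra h1; rw [decide_eq_true h1', decide_eq_false h1] at hfst; exact Bool.noConfusion hfst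
    have h2 : (2 ≤ t ↔ 2 ≤ t') := by
      constructor
      · intro h1; by_contra h1'; rw [decide_eq_true h1, decide_eq_false h1'] at hsnd; exact Bool.noConfusion hsnd
      · intro h1'; by_contra h1; rw [decide_eq_true h1', decide_eq_false h1] at hsnd; exact Bool.noConfusion hsnd
    omega
  · funext j
    by_cases hj : j.val < a
    · have := congr_fun h ⟨j.val, by omega⟩
      rwa [emb_of_lt ha t v _ hj, emb_of_lt ha t' v' _ hj] at this
    · have := congr_fun h ⟨j.val + 2, by omega⟩
      rw [emb_of_ge a t v _ (by simp; omega), emb_of_ge a t' v' _ (by simp; omega)] at this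
      have hj' : (⟨j.val + 2 - 2, by omega⟩ : Fin m) = j := Fin.ext (by simp)
      rw [hj'] at this
      exact Bool.not_inj this

/-! ### Weights along the chart -/
/-- Two index functions agreeing off two points: the sums differ by the values at those points. -/
theorem sum_eq_of_agree_off_two {N : ℕ} (f g : Fin N → ℕ) (i₁ i₂ : Fin N) (hne : i₁ ≠ i₂)
    (h : ∀ i, i ≠ i₁ → i ≠ i₂ → f i = g i) :
    ∑ i, f i + g i₁ + g i₂ = ∑ i, g i + f i₁ + f i₂ := by
  rw [← Finset.add_sum_erase _ f (mem_univ i₁), ← Finset.add_sum_erase _ g (mem_univ i₁),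
    ← Finset.add_sum_erase _ f (Finset.mem_erase.2 ⟨hne.symm, mem_univ i₂⟩),
    ← Finset.add_sum_erase _ g (Finset.mem_erase.2 ⟨hne.symm, mem_univ i₂⟩)]
  have hrest : ∑ x ∈ (univ.erase i₁).erase i₂, f x = ∑ x ∈ (univ.erase i₁).erase i₂, g x :=
    Finset.sum_congr rfl fun i hi => by
      rw [Finset.mem_erase, Finset.mem_erase] at hi
      exact h i hi.2.1 hi.1
  rw [hrest]; ring
/-- `|u_t| = |u_0| + t` for `t ≤ 2`. -/
theorem wt_emb {a : ℕ} (ha : a ≤ m) {t : ℕ} (ht : t < 3) (v : Fin m → Bool) :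
    wt (emb a t v) = wt (emb a 0 v) + t := by
  unfold wt
  rw [Finset.card_filter, Finset.card_filter]
  have key := sum_eq_of_agree_off_two (fun i => if emb a t v i = true then 1 else 0)
    (fun i => if emb a 0 v i = true then 1 else 0) ⟨a, by omega⟩ ⟨a + 1, by omega⟩
    (by simp) (fun i h₁ h₂ => by
      rw [emb_agree_off_pair a t 0 v i (fun h => h₁ (Fin.ext h)) (fun h => h₂ (Fin.ext h))])
  simp only [emb_at_fst a _ v ⟨a, _⟩ rfl, emb_at_snd a _ v ⟨a + 1, _⟩ rfl] at key
  have h0 : ¬ (1 ≤ 0) := by omega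
  have h0' : ¬ (2 ≤ 0) := by omega
  simp only [h0, h0', decide_false] at key
  rcases (show t = 0 ∨ t = 1 ∨ t = 2 by omega) with rfl | rfl | rfl
  · simp
  · simpa using key
  · simpa using key
/-- Prefix weights before the pair do not see it: `W_g(u_t) = W_g(u_0)` for `g ≤ a`. -/
theorem wtPrefix_emb_of_le (a : ℕ) (t : ℕ) (v : Fin m → Bool) {g : ℕ} (hg : g ≤ a) :
    wtPrefix (emb a t v) g = wtPrefix (emb a 0 v) g := by
  unfold wtPrefix
  congr 1
  ext i
  simp only [mem_filter, mem_univ, true_and]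
  constructor
  · rintro ⟨hi, hu⟩
    exact ⟨hi, by rwa [emb_agree_off_pair a 0 t v i (by omega) (by omega)]⟩
  · rintro ⟨hi, hu⟩
    exact ⟨hi, by rwa [emb_agree_off_pair a t 0 v i (by omega) (by omega)]⟩
/-- Prefix weights after the pair see all of it: `W_g(u_t) = W_g(u_0) + t` for `g ≥ a + 2`, `t ≤ 2`. -/
theorem wtPrefix_emb_of_ge {a : ℕ} (ha : a ≤ m) {t : ℕ} (ht : t < 3) (v : Fin m → Bool) {g : ℕ}
    (hg : a + 2 ≤ g) : wtPrefix (emb a t v) g = wtPrefix (emb a 0 v) g + t := by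
  unfold wtPrefix
  rw [Finset.card_filter, Finset.card_filter]
  have key := sum_eq_of_agree_off_two (fun i => if i.val < g ∧ emb a t v i = true then 1 else 0)
    (fun i => if i.val < g ∧ emb a 0 v i = true then 1 else 0) ⟨a, by omega⟩ ⟨a + 1, by omega⟩
    (by simp) (fun i h₁ h₂ => by
      rw [emb_agree_off_pair a t 0 v i (fun h => h₁ (Fin.ext h)) (fun h => h₂ (Fin.ext h))])
  simp only [emb_at_fst a _ v ⟨a, _⟩ rfl, emb_at_snd a _ v ⟨a + 1, _⟩ rfl] at key
  have h0 : ¬ (1 ≤ 0) := by omega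
  have h0' : ¬ (2 ≤ 0) := by omega
  have hga : a < g := by omega
  have hga' : a + 1 < g := by omega
  simp only [h0, h0', decide_false, hga, hga', true_and] at key
  rcases (show t = 0 ∨ t = 1 ∨ t = 2 by omega) with rfl | rfl | rfl
  · simp
  · simpa using key
  · simpa using key

/-! ### Near cuts, relative states, the counts `Q_ρ` -/
/-- The NEAR cuts of the pair at `a` with locality radius `w`: `a − w ≤ g ≤ a + 2 + w` (all other cuts are far and,
under the locality hypothesis, do not read the pair). -/
def near (m a w : ℕ) : Finset (Fin (m + 3)) :=
  univ.filter fun g : Fin (m + 3) => ¬ (g.val + w < a ∨ a + 2 + w < g.val)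
/-- `|near| ≤ 2w + 3`. -/
theorem card_near_le (m a w : ℕ) : (near m a w).card ≤ 2 * w + 3 := by
  calc (near m a w).card ≤ (Finset.Icc (a - w) (a + 2 + w)).card := by
        refine Finset.card_le_card_of_injOn (fun g => g.val) (fun g hg => ?_) (fun g _ g' _ h => Fin.ext h)
        unfold near at hg
        rw [Finset.mem_coe, mem_filter] at hg
        rw [Finset.mem_coe, Finset.mem_Icc]
        change a - w ≤ g.val ∧ g.val ≤ a + 2 + w
        omega
    _ ≤ 2 * w + 3 := by rw [Nat.card_Icc]; omega
/-- The RELATIVE STATE of cut `g` on the representative `u_t`: `g + W_g(u_t) + 2(a + W_a(u_t)) ≡ state(g) − state(a)`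
`(mod 3)`. -/
def relSt (a t g : ℕ) (v : Fin m → Bool) : ℕ :=
  g + wtPrefix (emb a t v) g + 2 * (a + wtPrefix (emb a t v) a)
/-- Locality of the relative state: `g + W_g + 2(a + W_a) (mod 3)` only reads the bits between `g` and `a`. -/
theorem relSt_mod_eq_of_agree {N : ℕ} (a g : ℕ) (u u' : Fin N → Bool)
    (h : ∀ i : Fin N, min g a ≤ i.val → i.val < max g a → u i = u' i) :
    (g + wtPrefix u g + 2 * (a + wtPrefix u a)) % 3 = (g + wtPrefix u' g + 2 * (a + wtPrefix u' a)) % 3 := by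
  rcases le_total g a with hga | hag
  · have hmid : (univ.filter fun i : Fin N => g ≤ i.val ∧ i.val < a ∧ u i = true) =
        (univ.filter fun i : Fin N => g ≤ i.val ∧ i.val < a ∧ u' i = true) := by
      ext i
      simp only [mem_filter, mem_univ, true_and]
      constructor
      · rintro ⟨h1, h2, h3⟩
        exact ⟨h1, h2, by rwa [← h i (by rw [Nat.min_eq_left hga]; exact h1) (by rw [Nat.max_eq_right hga]; exact h2)]⟩
      · rintro ⟨h1, h2, h3⟩
        exact ⟨h1, h2, by rwa [h i (by rw [Nat.min_eq_left hga]; exact h1) (by rw [Nat.max_eq_right hga]; exact h2)]⟩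
    rw [wtPrefix_eq_add_midCount u hga, wtPrefix_eq_add_midCount u' hga, hmid]
    omega
  · have hmid : (univ.filter fun i : Fin N => a ≤ i.val ∧ i.val < g ∧ u i = true) =
        (univ.filter fun i : Fin N => a ≤ i.val ∧ i.val < g ∧ u' i = true) := by
      ext i
      simp only [mem_filter, mem_univ, true_and]
      constructor
      · rintro ⟨h1, h2, h3⟩
        exact ⟨h1, h2, by rwa [← h i (by rw [Nat.min_eq_right hag]; exact h1) (by rw [Nat.max_eq_left hag]; exact h2)]⟩
      · rintro ⟨h1, h2, h3⟩
        exact ⟨h1, h2, by rwa [h i (by rw [Nat.min_eq_right hag]; exact h1) (by rw [Nat.max_eq_left hag]; exact h2)]⟩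
    rw [wtPrefix_eq_add_midCount u hag, wtPrefix_eq_add_midCount u' hag, hmid]
    omega
/-- The near count against residue `ρ`: `Q_ρ(v) = Σ_{t<3} #{g near : y_g(u_t) = 1 ∧ ρ + t + relSt ≢ 0 (mod 3)}`.  It is
`c`-free and reads `v` only through the near firing patterns and the bits within distance `w` of the pair. -/
def Q (y : Fin (m + 3) → (Fin (m + 2) → Bool) → Bool) (a w ρ : ℕ) (v : Fin m → Bool) : ℕ :=
  ∑ t ∈ range 3, ((near m a w).filter fun g =>
    y g (emb a t v) = true ∧ (ρ + t + relSt a t g.val v) % 3 ≠ 0).card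
/-- The hidden residue of the fibre: `κ(v) ≡ c + |u_0| + state(a)`. -/
def kappa (c a : ℕ) (v : Fin m → Bool) : ℕ := (c + wt (emb a 0 v) + a + wtPrefix (emb a 0 v) a) % 3
/-- `κ(v) < 3`. -/
theorem kappa_lt (c a : ℕ) (v : Fin m → Bool) : kappa c a v < 3 := Nat.mod_lt _ (by norm_num)
/-- The fired-and-charged count whose parity is `ringWinU`. -/
def winCount (c : ℕ) (y : Fin (m + 3) → (Fin (m + 2) → Bool) → Bool) (u : Fin (m + 2) → Bool) : ℕ :=
  (univ.filter fun g : Fin (m + 3) => y g u = true ∧ (c + g.val + walkExp u g.val) % 3 ≠ 0).card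
/-- `ringWinU` is the parity of `winCount`. -/
theorem ringWinU_eq_decide (c : ℕ) (y : Fin (m + 3) → (Fin (m + 2) → Bool) → Bool) (u : Fin (m + 2) → Bool) :
    ringWinU c y u = decide (winCount c y u % 2 = 1) := rfl
/-- Three consecutive (or `2`-spaced) exponents hit every residue once: two of them are nonzero `mod 3`. -/
theorem sum3_indicator (f : ℕ → ℕ) (b k : ℕ) (hk : k = 1 ∨ k = 2) (hf : ∀ t, t < 3 → f t % 3 = (b + k * t) % 3) :
    (∑ t ∈ range 3, if f t % 3 ≠ 0 then 1 else 0) = 2 := by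
  rw [Finset.sum_range_succ, Finset.sum_range_succ, Finset.sum_range_succ, Finset.sum_range_zero]
  have h0 := hf 0 (by norm_num)
  have h1 := hf 1 (by norm_num)
  have h2 := hf 2 (by norm_num)
  rcases hk with rfl | rfl <;> split_ifs <;> omega

/-- The exponent of every cut on the representative `u_t`, relative to the fibre's hidden residue:
`c + g + e_g(u_t) ≡ κ(v) + t + relSt_t(g) (mod 3)`. -/
theorem exp_mod_eq {a : ℕ} (ha : a ≤ m) (c : ℕ) {t : ℕ} (ht : t < 3) (g : ℕ) (v : Fin m → Bool) :
    (c + g + walkExp (emb a t v) g) % 3 = (kappa c a v + t + relSt a t g v) % 3 := by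
  unfold walkExp relSt kappa
  have h1 := wt_emb ha ht v
  have h2 := wtPrefix_emb_of_le a t v (le_refl a)
  rw [h1, h2]
  omega

/-- **The three-speed parity identity.** If the far cuts do not read the pair, the fired-and-charged counts of the three
representatives add up, mod 2, to the near count `Q_κ(v)` (every fired far cut is charged on exactly two speeds). -/
theorem sum_winCount_mod_two {a w : ℕ} (ha : a ≤ m) (c : ℕ) (y : Fin (m + 3) → (Fin (m + 2) → Bool) → Bool)
    (hloc : ∀ g : Fin (m + 3), (g.val + w < a ∨ a + 2 + w < g.val) → ∀ u u' : Fin (m + 2) → Bool,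
      (∀ i : Fin (m + 2), i.val ≠ a → i.val ≠ a + 1 → u i = u' i) → y g u = y g u')
    (v : Fin m → Bool) :
    (∑ t ∈ range 3, winCount c y (emb a t v)) % 2 = Q y a w (kappa c a v) v % 2 := by
  -- split each count into near and far cuts
  have hsplit : ∀ t, winCount c y (emb a t v) =
      (∑ g ∈ near m a w, if (y g (emb a t v) = true ∧ (c + g.val + walkExp (emb a t v) g.val) % 3 ≠ 0) then 1 else 0) +
      ∑ g ∈ univ.filter (fun g : Fin (m + 3) => ¬ ¬ (g.val + w < a ∨ a + 2 + w < g.val)),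
        (if (y g (emb a t v) = true ∧ (c + g.val + walkExp (emb a t v) g.val) % 3 ≠ 0) then 1 else 0) := by
    intro t
    unfold winCount near
    rw [Finset.card_filter, Finset.sum_filter_add_sum_filter_not]
  -- near part = the summand of `Q_κ`
  have hnear : ∀ t ∈ range 3,
      (∑ g ∈ near m a w, if (y g (emb a t v) = true ∧ (c + g.val + walkExp (emb a t v) g.val) % 3 ≠ 0) then 1 else 0) =
      ((near m a w).filter fun g => y g (emb a t v) = true ∧ (kappa c a v + t + relSt a t g.val v) % 3 ≠ 0).card := by
    intro t ht
    rw [Finset.card_filter]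
    refine Finset.sum_congr rfl fun g _ => ?_
    rw [exp_mod_eq ha c (mem_range.1 ht) g.val v]
  -- far part: each fired far cut contributes exactly 2 over the three speeds
  have hfar : (∑ t ∈ range 3, ∑ g ∈ univ.filter (fun g : Fin (m + 3) => ¬ ¬ (g.val + w < a ∨ a + 2 + w < g.val)),
      (if (y g (emb a t v) = true ∧ (c + g.val + walkExp (emb a t v) g.val) % 3 ≠ 0) then 1 else 0)) % 2 = 0 := by
    rw [Finset.sum_comm]
    refine Nat.mod_eq_zero_of_dvd (Finset.dvd_sum fun g hg => ?_)
    have hgfar : g.val + w < a ∨ a + 2 + w < g.val := by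
      rw [mem_filter] at hg
      exact not_not.mp hg.2
    have hfire : ∀ t, y g (emb a t v) = y g (emb a 0 v) := fun t =>
      hloc g hgfar _ _ fun i h1 h2 => emb_agree_off_pair a t 0 v i h1 h2
    by_cases hy : y g (emb a 0 v) = true
    · have heq : (∑ t ∈ range 3, if (y g (emb a t v) = true ∧ (c + g.val + walkExp (emb a t v) g.val) % 3 ≠ 0)
            then 1 else 0) = ∑ t ∈ range 3, if (c + g.val + walkExp (emb a t v) g.val) % 3 ≠ 0 then 1 else 0 :=
        Finset.sum_congr rfl fun t _ => by simp only [hfire t, hy, true_and]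
      rw [heq]
      rcases hgfar with hl | hr
      · rw [sum3_indicator (fun t => c + g.val + walkExp (emb a t v) g.val)
          (c + g.val + wt (emb a 0 v) + wtPrefix (emb a 0 v) g.val) 1 (Or.inl rfl) (fun t ht => by
            show (c + g.val + walkExp (emb a t v) g.val) % 3 = _
            unfold walkExp
            rw [wt_emb ha ht v, wtPrefix_emb_of_le a t v (show g.val ≤ a by omega)]
            omega)]
      · rw [sum3_indicator (fun t => c + g.val + walkExp (emb a t v) g.val)
          (c + g.val + wt (emb a 0 v) + wtPrefix (emb a 0 v) g.val) 2 (Or.inr rfl) (fun t ht => by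
            show (c + g.val + walkExp (emb a t v) g.val) % 3 = _
            unfold walkExp
            rw [wt_emb ha ht v, wtPrefix_emb_of_ge ha ht v (show a + 2 ≤ g.val by omega)]
            omega)]
    · have heq : (∑ t ∈ range 3, if (y g (emb a t v) = true ∧ (c + g.val + walkExp (emb a t v) g.val) % 3 ≠ 0)
            then 1 else 0) = 0 :=
        Finset.sum_eq_zero fun t _ => by rw [if_neg]; rw [hfire t]; exact fun h => hy h.1
      rw [heq]
      exact dvd_zero 2
  have h1 : (∑ t ∈ range 3, winCount c y (emb a t v)) =
      (∑ t ∈ range 3, ∑ g ∈ near m a w,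
        (if (y g (emb a t v) = true ∧ (c + g.val + walkExp (emb a t v) g.val) % 3 ≠ 0) then 1 else 0)) +
      ∑ t ∈ range 3, ∑ g ∈ univ.filter (fun g : Fin (m + 3) => ¬ ¬ (g.val + w < a ∨ a + 2 + w < g.val)),
        (if (y g (emb a t v) = true ∧ (c + g.val + walkExp (emb a t v) g.val) % 3 ≠ 0) then 1 else 0) := by
    rw [← Finset.sum_add_distrib]
    exact Finset.sum_congr rfl fun t _ => hsplit t
  have h2 : (∑ t ∈ range 3, ∑ g ∈ near m a w,
      (if (y g (emb a t v) = true ∧ (c + g.val + walkExp (emb a t v) g.val) % 3 ≠ 0) then 1 else 0)) =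
      Q y a w (kappa c a v) v := by
    unfold Q
    exact Finset.sum_congr rfl hnear
  rw [h1, h2]
  omega

/-- **One of the three representatives loses** whenever the near count against the fibre's hidden residue is even. -/
theorem exists_speed_loses {a w : ℕ} (ha : a ≤ m) (c : ℕ) (y : Fin (m + 3) → (Fin (m + 2) → Bool) → Bool)
    (hloc : ∀ g : Fin (m + 3), (g.val + w < a ∨ a + 2 + w < g.val) → ∀ u u' : Fin (m + 2) → Bool,
      (∀ i : Fin (m + 2), i.val ≠ a → i.val ≠ a + 1 → u i = u' i) → y g u = y g u')
    (v : Fin m → Bool) (hQ : Q y a w (kappa c a v) v % 2 = 0) :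
    ∃ t, t < 3 ∧ ringWinU c y (emb a t v) = false := by
  by_contra hall
  push Not at hall
  have hwin : ∀ t, t < 3 → winCount c y (emb a t v) % 2 = 1 := by
    intro t ht
    have h := hall t ht
    rw [ringWinU_eq_decide] at h
    by_contra hne
    exact h (decide_eq_false hne)
  have hsum := sum_winCount_mod_two ha c y hloc v
  rw [hQ, Finset.sum_range_succ, Finset.sum_range_succ, Finset.sum_range_succ, Finset.sum_range_zero] at hsum
  have h0 := hwin 0 (by norm_num)
  have h1 := hwin 1 (by norm_num)
  have h2 := hwin 2 (by norm_num)
  omega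

/-! ### A losing residue always exists -/

/-- `Q_0 + Q_1 + Q_2` is even: every fired near cut on every speed is counted against exactly two residues. -/
theorem sum_Q_mod_two (y : Fin (m + 3) → (Fin (m + 2) → Bool) → Bool) (a w : ℕ) (v : Fin m → Bool) :
    (Q y a w 0 v + Q y a w 1 v + Q y a w 2 v) % 2 = 0 := by
  have hQ : ∀ ρ, Q y a w ρ v = ∑ t ∈ range 3, ∑ g ∈ near m a w,
      (if (y g (emb a t v) = true ∧ (ρ + t + relSt a t g.val v) % 3 ≠ 0) then 1 else 0) := fun ρ => by
    unfold Q
    exact Finset.sum_congr rfl fun t _ => Finset.card_filter _ _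
  have h3 : Q y a w 0 v + Q y a w 1 v + Q y a w 2 v = ∑ ρ ∈ range 3, Q y a w ρ v := by
    rw [Finset.sum_range_succ, Finset.sum_range_succ, Finset.sum_range_succ, Finset.sum_range_zero, zero_add]
  rw [h3]
  refine Nat.mod_eq_zero_of_dvd ?_
  simp_rw [hQ]
  rw [Finset.sum_comm]
  refine Finset.dvd_sum fun t _ => ?_
  rw [Finset.sum_comm]
  refine Finset.dvd_sum fun g _ => ?_
  by_cases hy : y g (emb a t v) = true
  · have heq : (∑ ρ ∈ range 3, if (y g (emb a t v) = true ∧ (ρ + t + relSt a t g.val v) % 3 ≠ 0) then 1 else 0) =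
        ∑ ρ ∈ range 3, if (ρ + t + relSt a t g.val v) % 3 ≠ 0 then 1 else 0 :=
      Finset.sum_congr rfl fun ρ _ => by simp only [hy, true_and]
    rw [heq, sum3_indicator (fun ρ => ρ + t + relSt a t g.val v) (t + relSt a t g.val v) 1 (Or.inl rfl)
      (fun ρ _ => by show (ρ + t + relSt a t g.val v) % 3 = _; omega)]
  · rw [Finset.sum_eq_zero fun ρ _ => by rw [if_neg]; exact fun h => hy h.1]
    exact dvd_zero 2

/-- The losing residue `ρ♭(v)`: the least `ρ ∈ {0,1,2}` with `Q_ρ(v)` even. -/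
def rhoBad (y : Fin (m + 3) → (Fin (m + 2) → Bool) → Bool) (a w : ℕ) (v : Fin m → Bool) : ℕ :=
  if Q y a w 0 v % 2 = 0 then 0 else if Q y a w 1 v % 2 = 0 then 1 else 2
/-- `ρ♭(v) < 3`. -/
theorem rhoBad_lt (y : Fin (m + 3) → (Fin (m + 2) → Bool) → Bool) (a w : ℕ) (v : Fin m → Bool) :
    rhoBad y a w v < 3 := by
  unfold rhoBad; split_ifs <;> norm_num

/-- `Q_{ρ♭(v)}(v)` is even. -/
theorem Q_rhoBad_mod_two (y : Fin (m + 3) → (Fin (m + 2) → Bool) → Bool) (a w : ℕ) (v : Fin m → Bool) :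
    Q y a w (rhoBad y a w v) v % 2 = 0 := by
  have h := sum_Q_mod_two y a w v
  unfold rhoBad
  split_ifs with h0 h1
  · exact h0
  · exact h1
  · omega

/-- `ρ♭` only depends on the values `Q_0, Q_1, Q_2`. -/
theorem rhoBad_congr {y : Fin (m + 3) → (Fin (m + 2) → Bool) → Bool} {a w : ℕ} {v v' : Fin m → Bool}
    (h : ∀ ρ, Q y a w ρ v = Q y a w ρ v') : rhoBad y a w v = rhoBad y a w v' := by
  unfold rhoBad
  rw [h 0, h 1]

/-- **The fibre of `v` contains a losing input** as soon as the hidden residue `κ(v)` is the losing residue `ρ♭(v)`. -/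
theorem exists_loss_of_kappa_eq {a w : ℕ} (ha : a ≤ m) (c : ℕ) (y : Fin (m + 3) → (Fin (m + 2) → Bool) → Bool)
    (hloc : ∀ g : Fin (m + 3), (g.val + w < a ∨ a + 2 + w < g.val) → ∀ u u' : Fin (m + 2) → Bool,
      (∀ i : Fin (m + 2), i.val ≠ a → i.val ≠ a + 1 → u i = u' i) → y g u = y g u')
    (v : Fin m → Bool) (hκ : kappa c a v = rhoBad y a w v) :
    ∃ t, t < 3 ∧ ringWinU c y (emb a t v) = false :=
  exists_speed_loses ha c y hloc v (by rw [hκ]; exact Q_rhoBad_mod_two y a w v)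

end PairLocal

end Summit.QuantumAdvantage.AdviceFreeQNC0
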